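import Summits.CriticalPhenomena.PercolationContinuityZ3.Theorems.Transplant.FKConnectivityAllQCountReweightedGluingLogConvex
import Summits.CriticalPhenomena.PercolationContinuityZ3.Theorems.PercNearOneGluingNoHeavyLowerTailFKUpperChain
import HarnessLib

/-!
# The chain link (AG-loc) for count-reweighted product measures: the node `AGlocLogConvexPos` (NOT asserted) and the kernel reduction
# (AG-loc) ⇒ additive gluing for an ARBITRARY probability measure, hence `AGlocLogConvexPos → AdditiveGluingLogConvexPos`

Support file (`--supports stmt-CriticalPhenomena-4575`), FK sub-lane `prim-bschramm-fk-1` (gen 13) of the post-continuity programme;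
builds on p205010 (kernel theorem, internal audit signed; external expert review pending).  One definition with the measure as a parameter
(`AGlocUnder`), one `@[conjecture]` node (NOT asserted), proofs; no named facts, no sorries; standard axioms.

(AG-loc) is the finite link of the p205010 chain just above additive gluing (`AGloc.additiveGluing_of_agloc_firstRank`, stated for
`prodBernoulli`): `μ(o ↔ A, o ↮ b) ≤ Σ_{a ∈ A} μ(P^o_a)·(1 − μ(a ↔ b))` with `P^o_a` the event "a is the first relay (in a rank compatible with
`a ↦ μ(a ↔ b)`) joined to `o`".  Here it is named for ANY measure (`AGlocUnder μ A o b` — the hypothesis of fk-2's measure-generic reduction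
`FK.additiveGluingUnder_of_agloc_firstRank`, `…FKUpperChain.lean`, which gives `AdditiveGluingUnder μ A o b` for every probability
measure: the patterns partition `{o ↔ A}`, so under `μ(a ↮ b) ≤ t` the right-hand side is `≤ t·μ(o ↔ A) ≤ t`).
NODE `AGlocLogConvexPos`: (AG-loc) for every count-reweighted measure `μ_h ∝ P_w·h(k)` (`crMeasure w h`) with `h > 0` LOG-CONVEX
(`h(j+1)² ≤ h(j)h(j+2)`) — NOT asserted; **`additiveGluingLogConvexPos_of_aglocLogConvexPos : AGlocLogConvexPos → AdditiveGluingLogConvexPos`**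
(fk-1 g12's node, p287398) is a kernel implication.
EVIDENCE (fk-1 g13 kit j134971, exact integers; memo bschramm/FROM-fk-1-g13-TWO-CLUSTER.md §6): on fk-1 g12's adversarial universe
(36,000 near-deterministic weighted graphs with 6–9 vertices — the universe on which additive gluing FAILS for monotone / level-concentrated
count weights, `not_additiveGluingCountPos`), ALL observers, ALL relay sets with `|A| ≤ 4`, ALL targets, 33 log-convex `h` (`q^k` for
`q = 10^{±1..±6}, 2^{±1}`, `k!`, `2^{k²}`, `10^{k²}`, V-shaped `M^{|k−j|}`, two-point FK mixtures): (AG-loc) 0 failures / 3,444,110,400 cells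
(65.2M placements); the companion link (GEN) 0 / 13,737,456,000; log-concave controls fail ≈ 9.3·10⁸ times; `|A| = 1` is the hub inequality,
whose validity for all graphs forces log-convexity (fk-1 g10 `logConvex_of_hub_all`) — so, on all evidence, the log-convex cone is exactly the
class of count reweightings on which the chain from (GEN) down survives.
[cite: KozmaNitzan2024, Conj. 1 (p. 3); Question 5 (p. 32)] [cite: Grimmett2006, §1.4 eq. (1.20) (p. 15); §3.9 (pp. 63–65)]
-/

noncomputable section

namespace Summit.CriticalPhenomena.PercolationContinuityZ3.Theorems

namespace FK

open MeasureTheory Set Literature.Probability.LatticeModels Literature.Probability.Percolation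
open scoped Classical

variable {n : ℕ}

/-! ### (AG-loc) with the measure as a parameter -/

/-- **(AG-loc) under `μ`** for the relay set `A`, observer `o`, target `b`: for every rank `r` injective on `A` and compatible with the
reliabilities (`r a < r a' → μ(a ↔ b) ≤ μ(a' ↔ b)`),
`μ((o ↔ A) ∩ (o ↮ b)) ≤ Σ_{a ∈ A} μ({o ↔ a} ∩ ⋂_{a' ∈ A, r a' < r a} {o ↮ a'})·(1 − μ(a ↔ b))` — a union bound localised on the first relay.
For `μ = prodBernoulli w` this is the hypothesis of `AGloc.additiveGluing_of_agloc_firstRank`. [cite: KozmaNitzan2024, Question 5 (p. 32)] -/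
def AGlocUnder (μ : Measure (BondConfig (Fin n))) (A : Finset (Fin n)) (o b : Fin n) : Prop :=
  ∀ r : Fin n → ℕ, Set.InjOn r ↑A →
    (∀ a ∈ A, ∀ a' ∈ A, r a < r a' → μ.real (openConn a b) ≤ μ.real (openConn a' b)) →
    μ.real ((⋃ a ∈ A, openConn o a) ∩ (openConn o b)ᶜ : Set (BondConfig (Fin n))) ≤
      ∑ a ∈ A, μ.real (openConn o a ∩ ⋂ a' ∈ A.filter (fun a' => r a' < r a), (openConn o a')ᶜ : Set (BondConfig (Fin n))) *
        (1 - μ.real (openConn a b))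

/-- **(AG-loc) ⇒ additive gluing, for ANY probability measure** on the configurations of `Fin n` (one relay set, observer, target) —
a renaming of fk-2's `FK.additiveGluingUnder_of_agloc_firstRank`. [cite: KozmaNitzan2024, Conj. 1 (p. 3), Question 5 (p. 32)] -/
theorem additiveGluingUnder_of_aglocUnder (μ : Measure (BondConfig (Fin n))) [IsProbabilityMeasure μ] (A : Finset (Fin n)) (o b : Fin n)
    (h : AGlocUnder μ A o b) : AdditiveGluingUnder μ A o b :=
  additiveGluingUnder_of_agloc_firstRank μ A o b h

/-! ### The node: (AG-loc) for every log-convex count weight -/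

/-- **(AG-loc) under every positive log-convex count reweighting of product measure**, on every finite weighted graph, every relay set,
observer and target.  CONJECTURE-SHAPED STATEMENT, NOT asserted.  Evidence (fk-1 g13 kit j134971, exact): 0 failures in 3,444,110,400
cells on the adversarial universe (n ≤ 9, |A| ≤ 4, 33 log-convex weights); log-concave controls fail; the |A| = 1 case is the hub inequality,
for which log-convexity is NECESSARY (fk-1 g10).  Implies `AdditiveGluingLogConvexPos` (`additiveGluingLogConvexPos_of_aglocLogConvexPos`).
[cite: KozmaNitzan2024, Question 5 (p. 32)] [cite: Grimmett2006, §3.9 (pp. 63–65)] -/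
@[conjecture] def AGlocLogConvexPos : Prop :=
  ∀ (n : ℕ) (w : Sym2 (Fin n) → unitInterval) (h : ℕ → ℝ), (∀ k, 0 < h k) → (∀ j, h (j + 1) * h (j + 1) ≤ h j * h (j + 2)) →
    ∀ (A : Finset (Fin n)) (o b : Fin n), AGlocUnder (crMeasure w h) A o b

/-- **`AGlocLogConvexPos → AdditiveGluingLogConvexPos`** (the chain step (AG-loc) ⇒ additive gluing, transplanted to every log-convex
count-reweighted measure). [cite: KozmaNitzan2024, Conj. 1 (p. 3), Question 5 (p. 32)] -/
theorem additiveGluingLogConvexPos_of_aglocLogConvexPos (hloc : AGlocLogConvexPos) : AdditiveGluingLogConvexPos := by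
  intro n w h hpos hlc A o b
  haveI := isProbabilityMeasure_crMeasure w hpos
  exact additiveGluingUnder_of_aglocUnder (crMeasure w h) A o b (hloc n w h hpos hlc A o b)

/-- **… hence also `AdditiveGluingFKPos`** (random-cluster weights are log-convex). [cite: Grimmett2006, §1.4 eq. (1.20) (p. 15)] -/
theorem additiveGluingFKPos_of_aglocLogConvexPos (hloc : AGlocLogConvexPos) : AdditiveGluingFKPos :=
  additiveGluingFKPos_of_logConvexPos (additiveGluingLogConvexPos_of_aglocLogConvexPos hloc)

end FK

end Summit.CriticalPhenomena.PercolationContinuityZ3.Theorems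

end
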